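import Literature.NumberTheory.LFunctions.YoshidaWindowGramTailMS
import HarnessLib

/-!
# Kernel enclosures of Yoshida's matrix coefficients — VIII-b: structured form of the mean-square tail matrices

Source: H. Yoshida, Adv. Stud. Pure Math. **21** (1992) 281–325, §§6–7 [Yoshida1992HermitianForms].  Structured forms of
`Encl.U2EvenJMS` / `Encl.U2OddJMS` (part VIII-a) over named atoms — the mean-square tail constant `msConst`, the resonance
radius `msRes`, the Hankel entry with the two Gershgorin add-ons `hankHMS`, and the order-`J` atoms of part VII-a — with the
identifications `U2EvenJMS'_eq` / `U2OddJMS'_eq`; this is the shape the kernel boxes follow (next section of this part).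
Everything is proved; no named facts.
-/

open Real Complex Finset Matrix
open scoped BigOperators

namespace Literature.NumberTheory.LFunctions.Yoshida1992

open Literature.Analysis.SpecialFunctions Literature.Analysis.ValidatedNumerics.NumericsMP
open Literature.Analysis.ValidatedNumerics
open scoped ArithmeticFunction.vonMangoldt

namespace Encl

variable {a : ℝ}

/-- The prime mean square `A₂ = Σ_k (Λ_k k^{−1/2})²`. [cite: Yoshida1992HermitianForms, §7 pp. 305–312] -/
noncomputable def primeMeanSq (a : ℝ) : ℝ := ∑ k ∈ weilPrimeIndex a, ((Λ k : ℝ) / Real.sqrt k) ^ 2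

/-- The CRUDE (unguarded) resonance mass: frequencies whose sine datum is `0`. [cite: Yoshida1992HermitianForms, §7 pp. 305–312] -/
noncomputable def msCrude (a : ℝ) (s₁ : ℕ → ℝ) (sm sp : ℕ → ℕ → ℝ) : ℝ :=
  (π / 2) * (∑ k ∈ weilPrimeIndex a, if s₁ k = 0 then (Λ k : ℝ) / Real.sqrt k else 0)
    + (∑ k ∈ weilPrimeIndex a, ∑ k' ∈ (weilPrimeIndex a).erase k, if sm k k' = 0 then (Λ k : ℝ) / Real.sqrt k * ((Λ k' : ℝ) / Real.sqrt k') else 0) / 2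
    + (∑ k ∈ weilPrimeIndex a, ∑ k' ∈ weilPrimeIndex a, if sp k k' = 0 then (Λ k : ℝ) / Real.sqrt k * ((Λ k' : ℝ) / Real.sqrt k') else 0) / 2

/-- The GUARDED resonance radius `(π/2)Σ_k w_k/s₁(k) + ½Σ_{k≠k'} w_kw_k'/s₋ + ½Σ w_kw_k'/s₊` (terms with datum `0` vanish: `x/0 = 0`).
[cite: Yoshida1992HermitianForms, §7 pp. 305–312] -/
noncomputable def msRes (a : ℝ) (s₁ : ℕ → ℝ) (sm sp : ℕ → ℕ → ℝ) : ℝ :=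
  (π / 2) * (∑ k ∈ weilPrimeIndex a, (Λ k : ℝ) / Real.sqrt k / s₁ k)
    + (∑ k ∈ weilPrimeIndex a, ∑ k' ∈ (weilPrimeIndex a).erase k, (Λ k : ℝ) / Real.sqrt k * ((Λ k' : ℝ) / Real.sqrt k') / sm k k') / 2
    + (∑ k ∈ weilPrimeIndex a, ∑ k' ∈ weilPrimeIndex a, (Λ k : ℝ) / Real.sqrt k * ((Λ k' : ℝ) / Real.sqrt k') / sp k k') / 2

/-- The mean-square tail constant with the tail-sup edge `t = a(1+E)/(πY)` (`Y = B₃` even, `B₃ + 1` odd).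
[cite: Yoshida1992HermitianForms, §7 pp. 305–312] -/
noncomputable def msConst (a : ℝ) (Y : ℕ) (s₁ : ℕ → ℝ) (sm sp : ℕ → ℕ → ℝ) : ℝ :=
  (π / 4 + a * (1 + weilArchDensity (2 * a)) / (π * Y)) ^ 2 + primeMeanSq a / 2
    + 2 * (a * (1 + weilArchDensity (2 * a)) / (π * Y)) * primeMass a + msCrude a s₁ sm sp

/-- Hankel entry of the mean-square tail: `c·hankP + [j = j'](c·Σ hankM·B^{p}/B^{p} + Σ R/B₃^{p_j+p_j''}·B^{p}/B^{p})`.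
[cite: Yoshida1992HermitianForms, §7 pp. 305–312] -/
noncomputable def hankHMS (c R : ℝ) (p : ℕ → ℕ) (X Y B Z Je : ℕ) (j j' : ℕ) : ℝ :=
  c * hankP (p j + p j' - 1) X Y
    + (if j = j' then c * (∑ j' ∈ Finset.range Je, hankM (p j + p j' - 1) X Y * (B : ℝ) ^ (p j') / (B : ℝ) ^ (p j))
        + (∑ j' ∈ Finset.range Je, R / (Z : ℝ) ^ (p j + p j') * (B : ℝ) ^ (p j') / (B : ℝ) ^ (p j)) else 0)

/-- Structured `U₂⁺` (mean-square tail). [cite: Yoshida1992HermitianForms, §7 pp. 305–312] -/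
noncomputable def U2EvenJMS' (a θ η d₀ : ℝ) (B B₃ J : ℕ) (s₁ : ℕ → ℝ) (sm sp : ℕ → ℕ → ℝ) (i i' : ℕ) : ℝ :=
  (1 + θ) * (1 + η) * (1 / (π ^ 2 * d₀))
      * (∑ j ∈ Finset.range J, ∑ j' ∈ Finset.range J,
          hankHMS (msConst a B₃ s₁ sm sp) (msRes a s₁ sm sp) pA (B₃ - 1) B₃ B B₃ J j j' * vAe i j * vAe i' j')
    + (1 + θ) * (1 + η⁻¹) * (1 / d₀)
      * (∑ r ∈ Finset.range J, ∑ r' ∈ Finset.range J, hankH pB (B₃ - 1) B₃ B J r r' * vBe a i r * vBe a i' r')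
    + (if i = i' then (1 + θ⁻¹) * ((B : ℝ) / (d₀ * ((4 * J + 1 : ℕ) * (((B₃ - 1 : ℕ) : ℝ)) ^ (4 * J + 1)))) * rhoE a J i ^ 2 else 0)

/-- The structured form is the verbatim one (even). [cite: Yoshida1992HermitianForms, §7 pp. 305–312] -/
theorem U2EvenJMS'_eq (a θ η d₀ : ℝ) (B B₃ J : ℕ) (s₁ : ℕ → ℝ) (sm sp : ℕ → ℕ → ℝ) (i i' : ℕ) :
    U2EvenJMS' a θ η d₀ B B₃ J s₁ sm sp i i' = U2EvenJMS a θ η d₀ B B₃ J s₁ sm sp i i' := by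
  simp only [U2EvenJMS', U2EvenJMS, hankHMS, hankH, hankP, hankM, pA, pB, vAe, vBe, rhoE, cF, qq, s2r, ccoef, modeF,
    msConst, msCrude, msRes, primeMeanSq, primeMass]

/-- Structured `U₂⁻` (mean-square tail). [cite: Yoshida1992HermitianForms, §7 pp. 305–312] -/
noncomputable def U2OddJMS' (a θ η d₀ : ℝ) (B B₃ J : ℕ) (s₁ : ℕ → ℝ) (sm sp : ℕ → ℕ → ℝ) (k k' : ℕ) : ℝ :=
  (1 + θ) * (1 + η) * (1 / (π ^ 2 * d₀))
      * (∑ j ∈ Finset.range J, ∑ j' ∈ Finset.range J,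
          hankHMS (msConst a (B₃ + 1) s₁ sm sp) (msRes a s₁ sm sp) pOA B₃ (B₃ + 1) B (B₃ + 1) J j j' * vAo k j * vAo k' j')
    + (1 + θ) * (1 + η⁻¹) * (1 / d₀)
      * (∑ r ∈ Finset.range J, ∑ r' ∈ Finset.range J, hankH pOB B₃ (B₃ + 1) B J r r' * vBo a k r * vBo a k' r')
    + (if k = k' then (1 + θ⁻¹) * ((B : ℝ) / (d₀ * ((4 * J + 1 : ℕ) * (B₃ : ℝ) ^ (4 * J + 1)))) * rhoO a J k ^ 2 else 0)

/-- The structured form is the verbatim one (odd). [cite: Yoshida1992HermitianForms, §7 pp. 305–312] -/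
theorem U2OddJMS'_eq (a θ η d₀ : ℝ) (B B₃ J : ℕ) (s₁ : ℕ → ℝ) (sm sp : ℕ → ℕ → ℝ) (k k' : ℕ) :
    U2OddJMS' a θ η d₀ B B₃ J s₁ sm sp k k' = U2OddJMS a θ η d₀ B B₃ J s₁ sm sp k k' := by
  simp only [U2OddJMS', U2OddJMS, hankHMS, hankH, hankP, hankM, pOA, pOB, vAo, vBo, rhoO, cF, qq, s2r, wcoef, modeF,
    msConst, msCrude, msRes, primeMeanSq, primeMass]

end Encl

end Literature.NumberTheory.LFunctions.Yoshida1992
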